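import Literature.AnabelianGeometry.EtaleTheta.BaseFieldHullConstants
import Literature.AnabelianGeometry.EtaleTheta.DivisorMonoids
import HarnessLib

/-!
# [EtTh] Def. 3.3 (iii) / Def. 3.6 (iv) for the BASE-FIELD-THEORETIC HULL over the genuine base `B^temp(Π)⁰` (small model
# `CosetCat Π`), part 2: `Φ₀(U) = (1/e_U)·ℤ_{≥0}`, `div₀ = ord`, and the Def. 3.3 (iii) datum `DivisorMonoids.bsFldHull`

S. Mochizuki, *The étale theta function …*, Publ. RIMS **45** (2009) [MochizukiEtTh2009]: Def. 3.3 (iii) p.299 (PDF p.73)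
(«`Φ₀(Y^log) := lim Div⁺(Z^log_∞)^{Gal}` … together with a natural transformation `B₀ → Φ₀^gp` [given by assigning to a
log-meromorphic function its log-divisor of zeroes and poles] … `Φ₀^cnst ⊆ Φ₀^gp` the image of `F₀`»), Rmk. 3.3.1 p.299 (PDF p.73)
(primes of `Φ₀(Y)` ↔ Galois orbits of prime log-divisors), Def. 3.6 (iv) p.304 (PDF p.78) («the base-field-theoretic hull
`C^{bs-fld}` … a `p`-adic Frobenioid»); [MochizukiFrdII2008] Ex. 1.1 (i) p.7 (`ord(O_K^▷)`).
[cite: MochizukiEtTh2009, Def 3.3 (iii) p.299 (PDF p.73); Def 3.6 (iv) p.304 (PDF p.78)]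

abc-iut cell, layer L2, seat abc-iut-L2-d3 (gen 10); L2-lead ruling R1112 «CONST-DICT CARRIER = C^{bs-fld} HULL OVER THE GENUINE
BASE».  CLASS (b) CONSTRUCTION, part 2 of 2, over part 1 (`BaseFieldHullConstants.lean`: `fixFld`, `idx = e_U`, `eqvFun = B₀(U)`,
`ev`, `ofFixed`, `pullFun`) and the frozen `DivisorMonoids` interface (abc-iut-L2-t3), for ANY topological group `Γ` with
`a : Γ → G_{ℚ_p}` carrying open subgroups to open subgroups (`ha`):
* §4 **`phiSub a ha U = Φ₀(U) := (1/e_U)·ℤ_{≥0} ⊆ ℚ`** (the powers of `genQ U = 1/e_U` in `Multiplicative ℚ`; = `ord(O_{K_U}^▷)`,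
  ONE prime: the special fibre, reduced) with `phiSubEquivNat : Φ₀(U) ≅ ℤ_{≥0}` (Rmk. 3.3.1); along a covering map `Γ/V → Γ/U`:
  **`e_U ∣ e_V`** (`idx_dvd_of_hom` — the uniformiser of `K_U`, read in `K_V` as a Galois translate, has order `1/e_U ∈ (1/e_V)ℤ`),
  so the pull-back `pullPhi f` is the INCLUSION `(1/e_U)ℤ_{≥0} ⊆ (1/e_V)ℤ_{≥0}`, injective and divisibility-reflecting;
* §5 **`divZero a ha U = div₀(U) : B₀(U) → Φ₀(U)^gp`, `b ↦ ord(ev b) = (1/e_U)^{e_U·ord(ev b)}`** (`ordIdx`, an INTEGER by §1), natural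
  in `U` (`divZero_pullFun`, from the pull-back invariance of `ord`); every element of `Φ₀(U)` is the divisor of a constant
  (`exists_divZero_eq_of`: `Φ₀^cnst = Φ₀`);
* §6 **`DivisorMonoids.bsFldHull a ha : DivisorMonoids (CosetCat Γ)`** — `Φ₀`, `B₀`, `div₀`, `F₀ := B₀`, `ncsp₀ := Φ₀`, `csp₀ := 1`,
  every field of Def. 3.3 (iii) CONSTRUCTED — with the one-liners the Def. 3.6 (ii) engine `TemperedFrobenioid.ofRankOneBase`
  (abc-iut-w6-d048) consumes: `bsFldHull_Φ₀_map_injective`, `…_reflects_dvd`, `bsFldHull_B₀_map_injective`, `bsFldHull_exists_div₀_eq`.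
HONEST LABEL: genuine constants (`ℚ̄_p`, genuine Galois action through `a`) but DEGENERATE GEOMETRY — no non-constant rational
functions, no cusps, one prime per covering; this is the constants-part `C^{bs-fld}` of print's tempered Frobenioid read as
Def. 3.3 (iii) data on its own, NOT the tempered Frobenioid of a Tate curve.  No instance, no notation, no `Prop`-valued definition,
no sorry; nothing here bears on [IUTchIII] Cor. 3.12; no side taken; typed ≠ proved elsewhere.
-/

noncomputable section

namespace Literature.AnabelianGeometry.EtaleTheta

open CategoryTheory Opposite Multiplicative Literature.AlgebraicGeometry.Frobenioids Literature.AnabelianGeometry.SemiGraphs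
  Literature.AlgebraicGeometry.Frobenioids.RationalOrd

namespace BsFldHull

variable (p : ℕ) [Fact p.Prime] {Γ : Type} [Group Γ] [TopologicalSpace Γ] (a : Γ →* GQp p)
  (ha : ∀ U : OpenSubgroup Γ, IsOpen ((U.toSubgroup.map a : Subgroup (GQp p)) : Set (GQp p)))

/-! ## §4 `Φ₀(U) = (1/e_U)·ℤ_{≥0} ⊆ ℚ` — the value monoid, one prime -/

/-- The generator `1/e_U ∈ ℚ` of the value group of `K_U` (written multiplicatively), the reduced special fibre of `Γ/U`.
[cite: MochizukiFrdII2008, Ex 1.1 (i) p.7] -/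
def genQ (U : OpenSubgroup Γ) : Multiplicative ℚ := ofAdd (1 / (idx p a ha U : ℚ))

/-- `toAdd (genQ U ^ n) = n / e_U`. [cite: MochizukiFrdII2008, Ex 1.1 (i) p.7] -/
theorem toAdd_genQ_pow (U : OpenSubgroup Γ) (n : ℕ) : toAdd (genQ p a ha U ^ n) = (n : ℚ) / idx p a ha U := by
  rw [genQ, ← ofAdd_nsmul, toAdd_ofAdd, nsmul_eq_mul]
  ring

/-- `toAdd (genQ U ^ m) = m / e_U` for `m ∈ ℤ`. [cite: MochizukiFrdII2008, Ex 1.1 (i) p.7] -/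
theorem toAdd_genQ_zpow (U : OpenSubgroup Γ) (m : ℤ) : toAdd (genQ p a ha U ^ m) = (m : ℚ) / idx p a ha U := by
  rw [genQ, ← ofAdd_zsmul, toAdd_ofAdd, zsmul_eq_mul]
  ring

/-- `n ↦ (1/e_U)^n` is injective (`1/e_U ≠ 0`). [cite: MochizukiFrdII2008, Ex 1.1 (i) p.7] -/
theorem genQ_pow_injective (U : OpenSubgroup Γ) : Function.Injective fun n : ℕ => genQ p a ha U ^ n := by
  intro m n h
  have h' := congrArg toAdd h
  simp only [toAdd_genQ_pow] at h'
  rw [div_left_inj' (idx_cast_ne_zero p a ha U)] at h'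
  exact_mod_cast h'

/-- **`Φ₀(U) := (1/e_U)·ℤ_{≥0}`**, the monoid of effective log-divisors of `Γ/U` supported on the special fibre, read in `ℚ` through
`ord` (= `ord(O_{K_U}^▷)`, [FrdII] Ex. 1.1 (i)). [cite: MochizukiEtTh2009, Def 3.3 (iii) p.299 (PDF p.73)] -/
abbrev phiSub (U : OpenSubgroup Γ) : Submonoid (Multiplicative ℚ) := Submonoid.powers (genQ p a ha U)

/-- Membership in `Φ₀(U)`: `q = n/e_U` for some `n ∈ ℕ`. [cite: MochizukiEtTh2009, Def 3.3 (iii) p.299 (PDF p.73)] -/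
theorem mem_phiSub_iff (U : OpenSubgroup Γ) (q : Multiplicative ℚ) : q ∈ phiSub p a ha U ↔ ∃ n : ℕ, genQ p a ha U ^ n = q :=
  Submonoid.mem_powers_iff _ _

/-- The generator as an element of `Φ₀(U)`. [cite: MochizukiEtTh2009, Def 3.3 (iii) p.299 (PDF p.73)] -/
def gen (U : OpenSubgroup Γ) : phiSub p a ha U := ⟨genQ p a ha U, Submonoid.mem_powers _⟩

/-- **`Φ₀(U) ≅ ℤ_{≥0}`** (one prime; Mathlib `Submonoid.powLogEquiv`). [cite: MochizukiEtTh2009, Rmk 3.3.1 p.299 (PDF p.73)] -/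
def phiSubEquivNat (U : OpenSubgroup Γ) : phiSub p a ha U ≃* Multiplicative ℕ :=
  (Submonoid.powLogEquiv (genQ_pow_injective p a ha U)).symm

/-- `(phiSubEquivNat U).symm n = gen ^ n`. [cite: MochizukiEtTh2009, Rmk 3.3.1 p.299 (PDF p.73)] -/
theorem phiSubEquivNat_symm_apply (U : OpenSubgroup Γ) (n : Multiplicative ℕ) :
    (phiSubEquivNat p a ha U).symm n = gen p a ha U ^ (toAdd n) := by
  apply Subtype.ext
  rw [phiSubEquivNat, MulEquiv.symm_symm, Submonoid.powLogEquiv_apply, Submonoid.pow_apply, SubmonoidClass.coe_pow]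
  rfl

/-- Every element of `Φ₀(U)` is a power of the generator. [cite: MochizukiEtTh2009, Rmk 3.3.1 p.299 (PDF p.73)] -/
theorem exists_eq_gen_pow (U : OpenSubgroup Γ) (m : phiSub p a ha U) : ∃ n : ℕ, m = gen p a ha U ^ n := by
  obtain ⟨n, hn⟩ := (mem_phiSub_iff p a ha U m).mp m.2
  exact ⟨n, Subtype.ext (by rw [SubmonoidClass.coe_pow]; exact hn.symm)⟩

/-- **`e_U ∣ e_V` along a covering map `Γ/V → Γ/U`** (`K_U ↪ K_V` up to the Galois translate `a(g)`: the uniformiser of `K_U`, read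
in `K_V`, has order `1/e_U ∈ (1/e_V)ℤ`). [cite: MochizukiFrdII2008, Ex 1.1 (i) p.7] -/
theorem idx_dvd_of_hom {V U : CosetCat Γ} (f : V ⟶ U) : idx p a ha U.sg ∣ idx p a ha V.sg := by
  obtain ⟨x, hx, hx0, hord⟩ := exists_mem_fixFld_ordFun_eq p a ha U.sg 1
  -- the constant `x` on `Γ/U`, pulled back to `Γ/V`, is a constant of `K_V` of the same order `1/e_U`
  set b : eqvFun p a V := pullFun p a f (ofFixed p a U (Units.mk0 x hx0) hx) with hb
  have hordb : ordFun p ((ev p a V b : (PadicAlgCl p)ˣ) : PadicAlgCl p) = 1 / idx p a ha U.sg := by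
    rw [hb, ordFun_ev_pullFun, ev_ofFixed, Units.val_mk0, hord, Int.cast_one]
  obtain ⟨m, hm⟩ := exists_ordFun_eq_of_mem_fixFld p a ha V.sg (ev_mem_fixFld p a V b) (ev p a V b).ne_zero
  rw [hordb] at hm
  have hU := idx_cast_ne_zero p a ha U.sg
  have hV := idx_cast_ne_zero p a ha V.sg
  have key : (idx p a ha V.sg : ℚ) = m * idx p a ha U.sg := by
    field_simp at hm
    linarith [hm]
  have hm0 : 0 ≤ m := by
    have h1 : (0 : ℚ) < idx p a ha V.sg := by exact_mod_cast idx_pos p a ha V.sg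
    have h2 : (0 : ℚ) < idx p a ha U.sg := by exact_mod_cast idx_pos p a ha U.sg
    rw [key] at h1
    exact_mod_cast (pos_of_mul_pos_left h1 h2.le).le
  refine ⟨m.toNat, ?_⟩
  have hmq : ((m.toNat : ℤ) : ℚ) = m := by exact_mod_cast Int.toNat_of_nonneg hm0
  have : (idx p a ha V.sg : ℚ) = ((idx p a ha U.sg * m.toNat : ℕ) : ℚ) := by
    push_cast
    rw [show ((m.toNat : ℕ) : ℚ) = ((m.toNat : ℤ) : ℚ) from rfl, hmq, key, mul_comm]
  exact_mod_cast this

/-- The generator of `Φ₀(U)` is a power of that of `Φ₀(V)`: `1/e_U = (e_V/e_U)·(1/e_V)`. [cite: MochizukiFrdII2008, Ex 1.1 (i) p.7] -/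
theorem genQ_eq_pow_of_hom {V U : CosetCat Γ} (f : V ⟶ U) :
    genQ p a ha U.sg = genQ p a ha V.sg ^ (idx p a ha V.sg / idx p a ha U.sg) := by
  obtain ⟨k, hk⟩ := idx_dvd_of_hom p a ha f
  have hU := idx_pos p a ha U.sg
  rw [hk, Nat.mul_div_cancel_left _ hU]
  apply toAdd.injective
  rw [toAdd_genQ_pow, genQ, toAdd_ofAdd, hk]
  have hU' := idx_cast_ne_zero p a ha U.sg
  have hk0 : (k : ℚ) ≠ 0 := by
    have := idx_pos p a ha V.sg
    rw [hk] at this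
    exact_mod_cast (Nat.pos_of_mul_pos_left this).ne'
  push_cast
  field_simp

/-- **`Φ₀(U) ⊆ Φ₀(V)` along `Γ/V → Γ/U`** (pull-back of log-divisors = inclusion of value monoids).
[cite: MochizukiEtTh2009, Def 3.3 (iii) p.299 (PDF p.73)] -/
theorem phiSub_le_of_hom {V U : CosetCat Γ} (f : V ⟶ U) : phiSub p a ha U.sg ≤ phiSub p a ha V.sg := by
  intro q hq
  obtain ⟨n, rfl⟩ := (mem_phiSub_iff p a ha U.sg q).mp hq
  rw [genQ_eq_pow_of_hom p a ha f, ← pow_mul]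
  exact Submonoid.pow_mem _ (Submonoid.mem_powers _) _

/-- The pull-back `Φ₀(U) → Φ₀(V)`: the inclusion. [cite: MochizukiEtTh2009, Def 3.3 (iii) p.299 (PDF p.73)] -/
def pullPhi {V U : CosetCat Γ} (f : V ⟶ U) : phiSub p a ha U.sg →* phiSub p a ha V.sg := Submonoid.inclusion (phiSub_le_of_hom p a ha f)

/-- The pull-back of `Φ₀` is the identity on underlying rationals. [cite: MochizukiEtTh2009, Def 3.3 (iii) p.299 (PDF p.73)] -/
@[simp] theorem coe_pullPhi {V U : CosetCat Γ} (f : V ⟶ U) (m : phiSub p a ha U.sg) : ((pullPhi p a ha f m : phiSub p a ha V.sg) : Multiplicative ℚ) = m :=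
  Submonoid.coe_inclusion _ m

/-- Pull-backs of `Φ₀` are injective. [cite: MochizukiEtTh2009, Def 3.3 (iii) p.299 (PDF p.73)] -/
theorem pullPhi_injective {V U : CosetCat Γ} (f : V ⟶ U) : Function.Injective (pullPhi p a ha f) :=
  Submonoid.inclusion_injective _

/-- Divisibility in `Φ₀(U)` is the order of `ℚ`. [cite: MochizukiEtTh2009, Def 3.3 (iii) p.299 (PDF p.73)] -/
theorem dvd_iff_toAdd_le (U : OpenSubgroup Γ) (m n : phiSub p a ha U) : m ∣ n ↔ toAdd (m : Multiplicative ℚ) ≤ toAdd (n : Multiplicative ℚ) := by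
  obtain ⟨i, rfl⟩ := exists_eq_gen_pow p a ha U m
  obtain ⟨j, rfl⟩ := exists_eq_gen_pow p a ha U n
  have he : (0 : ℚ) < idx p a ha U := by exact_mod_cast idx_pos p a ha U
  have hi : toAdd ((gen p a ha U ^ i : phiSub p a ha U) : Multiplicative ℚ) = (i : ℚ) / idx p a ha U := by
    rw [SubmonoidClass.coe_pow]; exact toAdd_genQ_pow p a ha U i
  have hj : toAdd ((gen p a ha U ^ j : phiSub p a ha U) : Multiplicative ℚ) = (j : ℚ) / idx p a ha U := by
    rw [SubmonoidClass.coe_pow]; exact toAdd_genQ_pow p a ha U j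
  rw [hi, hj, div_le_div_iff_of_pos_right he, Nat.cast_le]
  constructor
  · rintro ⟨c, hc⟩
    obtain ⟨k, rfl⟩ := exists_eq_gen_pow p a ha U c
    rw [← pow_add] at hc
    have h1 : i + k = j := genQ_pow_injective p a ha U (by
      have := congrArg (fun z : phiSub p a ha U => (z : Multiplicative ℚ)) hc
      rw [SubmonoidClass.coe_pow, SubmonoidClass.coe_pow] at this
      exact this.symm)
    omega
  · intro hij
    exact ⟨gen p a ha U ^ (j - i), by rw [← pow_add, Nat.add_sub_cancel' hij]⟩

/-- Pull-backs of `Φ₀` reflect divisibility. [cite: MochizukiEtTh2009, Def 3.3 (iii) p.299 (PDF p.73)] -/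
theorem pullPhi_reflects_dvd {V U : CosetCat Γ} (f : V ⟶ U) (m n : phiSub p a ha U.sg) (h : pullPhi p a ha f m ∣ pullPhi p a ha f n) : m ∣ n := by
  rw [dvd_iff_toAdd_le] at h ⊢
  simpa only [coe_pullPhi] using h

/-! ## §5 `div₀ = ord` at the base point, valued in `Φ₀(U)^gp` -/

/-- **`e_U · ord(ev b) ∈ ℤ`** — the order of a constant of `Γ/U` in units of the reduced special fibre `1/e_U`.
[cite: MochizukiEtTh2009, Def 3.3 (iii) p.299 (PDF p.73)] -/
def ordIdx (U : CosetCat Γ) (b : eqvFun p a U) : ℤ := ⌊(idx p a ha U.sg : ℚ) * ordFun p ((ev p a U b : (PadicAlgCl p)ˣ) : PadicAlgCl p)⌋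

/-- `ordIdx b / e_U = ord(ev b)` (no rounding: `ord(K_U^×) = (1/e_U)ℤ`). [cite: MochizukiEtTh2009, Def 3.3 (iii) p.299 (PDF p.73)] -/
theorem ordIdx_cast (U : CosetCat Γ) (b : eqvFun p a U) :
    (ordIdx p a ha U b : ℚ) = (idx p a ha U.sg : ℚ) * ordFun p ((ev p a U b : (PadicAlgCl p)ˣ) : PadicAlgCl p) := by
  obtain ⟨m, hm⟩ := exists_ordFun_eq_of_mem_fixFld p a ha U.sg (ev_mem_fixFld p a U b) (ev p a U b).ne_zero
  rw [ordIdx, hm, mul_div_cancel₀ _ (idx_cast_ne_zero p a ha U.sg), Int.floor_intCast]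

/-- `ordIdx` is additive. [cite: MochizukiEtTh2009, Def 3.3 (iii) p.299 (PDF p.73)] -/
theorem ordIdx_mul (U : CosetCat Γ) (b c : eqvFun p a U) : ordIdx p a ha U (b * c) = ordIdx p a ha U b + ordIdx p a ha U c := by
  have h : (ordIdx p a ha U (b * c) : ℚ) = ordIdx p a ha U b + ordIdx p a ha U c := by
    rw [ordIdx_cast, ordIdx_cast, ordIdx_cast, map_mul, Units.val_mul, ordFun_mul p (Units.ne_zero _) (Units.ne_zero _)]
    ring
  exact_mod_cast h

/-- `ordIdx` as a homomorphism `B₀(U) → ℤ`. [cite: MochizukiEtTh2009, Def 3.3 (iii) p.299 (PDF p.73)] -/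
def ordIdxHom (U : CosetCat Γ) : eqvFun p a U →* Multiplicative ℤ where
  toFun b := ofAdd (ordIdx p a ha U b)
  map_one' := by
    rw [← ofAdd_zero]
    congr 1
    have h := ordIdx_cast p a ha U 1
    rw [map_one, Units.val_one, ordFun_one, mul_zero] at h
    exact_mod_cast h
  map_mul' b c := by rw [← ofAdd_add, ordIdx_mul]

/-- **`div₀(U) : B₀(U) → Φ₀(U)^gp`, `b ↦ ord(ev b) = (1/e_U)^{ordIdx b}`** («assigning to a log-meromorphic function its log-divisor
of zeroes and poles»; for a constant `c ∈ K_U^×` this is `ord_{K_U}(c)` special fibres). [cite: MochizukiEtTh2009, Def 3.3 (iii) p.299 (PDF p.73)] -/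
def divZero (U : CosetCat Γ) : eqvFun p a U →* Algebra.GrothendieckGroup (phiSub p a ha U.sg) :=
  (zpowersHom _ (Algebra.GrothendieckGroup.of (gen p a ha U.sg))).comp (ordIdxHom p a ha U)

/-- `div₀ b = [gen]^{ordIdx b}`. [cite: MochizukiEtTh2009, Def 3.3 (iii) p.299 (PDF p.73)] -/
theorem divZero_apply (U : CosetCat Γ) (b : eqvFun p a U) :
    divZero p a ha U b = Algebra.GrothendieckGroup.of (gen p a ha U.sg) ^ ordIdx p a ha U b := rfl

/-- **Every effective log-divisor is the divisor of a constant**: `gen^n = div₀(ofFixed π^n)`-type witness (`hcnst` of the Def. 3.6 (ii)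
engine; print: `Φ₀^cnst`, and here `Φ₀^cnst = Φ₀`). [cite: MochizukiEtTh2009, Def 3.3 (iii) p.299 (PDF p.73)] -/
theorem exists_divZero_eq_of (U : CosetCat Γ) (m : phiSub p a ha U.sg) : ∃ b : eqvFun p a U, divZero p a ha U b = Algebra.GrothendieckGroup.of m := by
  obtain ⟨n, rfl⟩ := exists_eq_gen_pow p a ha U.sg m
  obtain ⟨x, hx, hx0, hord⟩ := exists_mem_fixFld_ordFun_eq p a ha U.sg n
  refine ⟨ofFixed p a U (Units.mk0 x hx0) hx, ?_⟩
  have hidx : ordIdx p a ha U (ofFixed p a U (Units.mk0 x hx0) hx) = n := by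
    have h := ordIdx_cast p a ha U (ofFixed p a U (Units.mk0 x hx0) hx)
    rw [ev_ofFixed, Units.val_mk0, hord, mul_div_cancel₀ _ (idx_cast_ne_zero p a ha U.sg)] at h
    exact_mod_cast h
  rw [divZero_apply, hidx, zpow_natCast, map_pow]

/-- **Naturality of `div₀`**: `div₀(b ∘ f) = Φ₀(f)^gp (div₀ b)` for a covering map `f : Γ/V → Γ/U`. [cite: MochizukiEtTh2009, Def 3.3 (iii) p.299 (PDF p.73)] -/
theorem divZero_pullFun {V U : CosetCat Γ} (f : V ⟶ U) (b : eqvFun p a U) :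
    divZero p a ha V (pullFun p a f b) = gpMap (pullPhi p a ha f) (divZero p a ha U b) := by
  obtain ⟨k, hk⟩ := idx_dvd_of_hom p a ha f
  have hU := idx_pos p a ha U.sg
  -- the exponents: `ordIdx_V (b ∘ f) = k · ordIdx_U b`
  have hidx : ordIdx p a ha V (pullFun p a f b) = k * ordIdx p a ha U b := by
    have h1 := ordIdx_cast p a ha V (pullFun p a f b)
    rw [ordFun_ev_pullFun, hk] at h1
    have h2 := ordIdx_cast p a ha U b
    have : (ordIdx p a ha V (pullFun p a f b) : ℚ) = k * ordIdx p a ha U b := by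
      rw [h1, h2]; push_cast; ring
    exact_mod_cast this
  -- the generators: `gen_U = gen_V ^ k` inside `Φ₀(V)`
  have hgen : pullPhi p a ha f (gen p a ha U.sg) = gen p a ha V.sg ^ k := by
    apply Subtype.ext
    rw [coe_pullPhi, SubmonoidClass.coe_pow]
    change genQ p a ha U.sg = genQ p a ha V.sg ^ k
    rw [genQ_eq_pow_of_hom p a ha f, hk, Nat.mul_div_cancel_left _ hU]
  rw [divZero_apply, divZero_apply, map_zpow, gpMap_of, hgen, map_pow, hidx, zpow_mul, zpow_natCast]

/-! ## §6 The Def. 3.3 (iii) datum of the base-field-theoretic hull -/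

/-- **`Φ₀` of the hull** as a monoid on `CosetCat Γ`: `U ↦ (1/e_U)ℤ_{≥0}`, pull-backs the inclusions.
[cite: MochizukiEtTh2009, Def 3.3 (iii) p.299 (PDF p.73)] -/
def PhiZero : (CosetCat Γ)ᵒᵖ ⥤ CommMonCat.{0} where
  obj U := CommMonCat.of (phiSub p a ha U.unop.sg)
  map f := CommMonCat.ofHom (pullPhi p a ha f.unop)
  map_id U := by apply CommMonCat.hom_ext; ext; rfl
  map_comp f g := by apply CommMonCat.hom_ext; ext; rfl

/-- **`B₀` of the hull** as a monoid on `CosetCat Γ`: `U ↦ Hom_Γ(Γ/U, ℚ̄_p^×)`, pull-backs by precomposition.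
[cite: MochizukiEtTh2009, Def 3.3 (iii) p.299 (PDF p.73)] -/
def BZero : (CosetCat Γ)ᵒᵖ ⥤ CommMonCat.{0} where
  obj U := CommMonCat.of (eqvFun p a U.unop)
  map f := CommMonCat.ofHom (pullFun p a f.unop)
  map_id U := by apply CommMonCat.hom_ext; ext; rfl
  map_comp f g := by apply CommMonCat.hom_ext; ext; rfl

/-- **The Def. 3.3 (iii) datum of the base-field-theoretic hull over `CosetCat Γ ≌ B^temp(Γ)⁰`**: `Φ₀(U) = (1/e_U)ℤ_{≥0}`,
`B₀(U) = F₀(U) = Hom_Γ(Γ/U, ℚ̄_p^×) ≅ K_U^×`, `div₀ = ord`, everything non-cuspidal — every field CONSTRUCTED.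
[cite: MochizukiEtTh2009, Def 3.3 (iii) p.299 (PDF p.73); Def 3.6 (iv) p.304 (PDF p.78)] -/
def _root_.Literature.AnabelianGeometry.EtaleTheta.DivisorMonoids.bsFldHull : DivisorMonoids.{0, 0, 0} (CosetCat Γ) where
  Φ₀ := PhiZero p a ha
  B₀ := BZero p a
  isUnit_B₀ U b := @Group.isUnit (↥(eqvFun p a U.unop)) _ b
  div₀ U := divZero p a ha U.unop
  div₀_natural f b := divZero_pullFun p a ha f.unop b
  F₀ _ := ⊤
  F₀_map _ _ _ := trivial
  ncsp₀ _ := ⊤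
  csp₀ _ := ⊥
  ncsp₀_map _ _ _ := trivial
  csp₀_map f x hx := by
    rw [Submonoid.mem_bot] at hx ⊢
    rw [hx, map_one]
  existsUnique_ncsp_csp U x := by
    refine ⟨(⟨x, trivial⟩, ⟨1, Submonoid.mem_bot.mpr rfl⟩), mul_one x, fun q hq => ?_⟩
    obtain ⟨⟨y, hy⟩, ⟨z, hz⟩⟩ := q
    have hz1 : z = 1 := Submonoid.mem_bot.mp hz
    subst hz1
    have hyx : y = x := by rw [← hq]; exact (mul_one y).symm
    subst hyx
    rfl

/-- `Φ₀` of the hull at `U` is `(1/e_U)ℤ_{≥0}`. [cite: MochizukiEtTh2009, Def 3.3 (iii) p.299 (PDF p.73)] -/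
theorem bsFldHull_Φ₀_obj (U : (CosetCat Γ)ᵒᵖ) : ((DivisorMonoids.bsFldHull p a ha).Φ₀.obj U : Type) = phiSub p a ha U.unop.sg := rfl

/-- `B₀` of the hull at `U` is `Hom_Γ(Γ/U, ℚ̄_p^×)`. [cite: MochizukiEtTh2009, Def 3.3 (iii) p.299 (PDF p.73)] -/
theorem bsFldHull_B₀_obj (U : (CosetCat Γ)ᵒᵖ) : ((DivisorMonoids.bsFldHull p a ha).B₀.obj U : Type) = eqvFun p a U.unop := rfl

/-- `F₀ = B₀`: every function of the hull is constant. [cite: MochizukiEtTh2009, Def 3.3 (iii) p.299 (PDF p.73)] -/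
theorem bsFldHull_F₀ (U : (CosetCat Γ)ᵒᵖ) : (DivisorMonoids.bsFldHull p a ha).F₀ U = ⊤ := rfl

/-- The pull-backs of `Φ₀` of the hull are injective. [cite: MochizukiEtTh2009, Def 3.3 (iii) p.299 (PDF p.73)] -/
theorem bsFldHull_Φ₀_map_injective {U V : (CosetCat Γ)ᵒᵖ} (f : U ⟶ V) : Function.Injective ((DivisorMonoids.bsFldHull p a ha).Φ₀.map f).hom :=
  pullPhi_injective p a ha f.unop

/-- The pull-backs of `Φ₀` of the hull reflect divisibility. [cite: MochizukiEtTh2009, Def 3.3 (iii) p.299 (PDF p.73)] -/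
theorem bsFldHull_Φ₀_map_reflects_dvd {U V : (CosetCat Γ)ᵒᵖ} (f : U ⟶ V) (m n : (DivisorMonoids.bsFldHull p a ha).Φ₀.obj U)
    (h : ((DivisorMonoids.bsFldHull p a ha).Φ₀.map f).hom m ∣ ((DivisorMonoids.bsFldHull p a ha).Φ₀.map f).hom n) : m ∣ n :=
  pullPhi_reflects_dvd p a ha f.unop m n h

/-- The pull-backs of `B₀` of the hull are injective. [cite: MochizukiEtTh2009, Def 3.3 (iii) p.299 (PDF p.73)] -/
theorem bsFldHull_B₀_map_injective {U V : (CosetCat Γ)ᵒᵖ} (f : U ⟶ V) : Function.Injective ((DivisorMonoids.bsFldHull p a ha).B₀.map f).hom :=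
  pullFun_injective p a f.unop

/-- **`hcnst`**: every element of `Φ₀(U)` is the divisor of a constant function (an element of `F₀(U) = B₀(U)`).
[cite: MochizukiEtTh2009, Def 3.3 (iii) p.299 (PDF p.73)] -/
theorem bsFldHull_exists_div₀_eq (U : (CosetCat Γ)ᵒᵖ) (m : (DivisorMonoids.bsFldHull p a ha).Φ₀.obj U) :
    ∃ b ∈ (DivisorMonoids.bsFldHull p a ha).F₀ U, (DivisorMonoids.bsFldHull p a ha).div₀ U b = Algebra.GrothendieckGroup.of m := by
  obtain ⟨b, hb⟩ := exists_divZero_eq_of p a ha U.unop m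
  exact ⟨b, trivial, hb⟩

end BsFldHull

end Literature.AnabelianGeometry.EtaleTheta

end
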